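import Summits.Ventures.HodgeRepro2.T6N41TauMain
import Summits.Ventures.HodgeRepro2.T6N43BergmanNSide
import Summits.Ventures.HodgeRepro2.T6N3ToyV

/-!
# T6PeriodInputToy2Tau — the τ′ layer's test datum on the JOINT TOY's sides (the v7 witness seam; Tier 6, M2;
definition lane; seat t6-p6, the (γ) assembly lineage)

Cell pub-hodge-repro2, Tier 6 (README §10), seat t6-p6. Count-neutral glue for the §10.5(ii)(d) witness of a
v7 M2 object (t6-lead's plan of record STATUS l. 11672 (c): the witness of v7 = T6PeriodInput6Toy2's pattern
re-run on the v7 binder set, the new displays THEOREMS on the toy). t6-p4's drop-in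
(route/t6-p4-lean/T6PeriodInput6PlacedTau.staged.lean) replaces v6's residual `hτ' : σ ≠ ⊥ → hypI` per side by the
τ′ layer's five binders — a pure-tensor test datum `Td : TauDatum M.d3.A M.sA` (T6N41Tau) and the displays
`Hyp.GQT2014_Thm11_4_ii_Rallis Td`, `Hyp.GQT2014_Sec11_6_Unramified Td` (T6N41TauHyp), with t6-p5's
`Hyp.GQT2014_Prop35_i` at the finite places — discharged by `TauDatum.hypI_of_rallis` (T6N41TauMain). t6-p4's own
witness `N41TauToy.toyTd` lives on t6-p3's degenerate toy side `N3Toy.side` (`L²([G]) = ℂ`) and t6-p5's `toyNSide`;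
the joint toy v2 (T6PeriodInput6Toy2 p409931) has its sides on t6-p3's `N3ToyV.sideV V f` (`L²([G]) = V` =
t6-p1's `LGw K`, the theta lift `Θ φ f = (φ · conj f) • f_A`, `π₀ = τ′iso = ⊤`) and its N4 sides on
`N43Toy.bergmanNSide` (`d41 = toyD41` with `S` = every place, `d42 = toyFinitePlaces`, `d43 = bergmanToy.toPlaces`).
This file supplies the test datum on THOSE carriers, in toyTd's pattern:
* `assembleV v x` = the quadruple `(φ₁, 1, 1, 1)` with
  `φ₁ := 2 · L(1) · (∏_v Z_v^*(½)(x_v)) · (∏_j Z^*_{τ′_j}(½)) · ⟪v, v⟫⁻¹` and the local factors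
  `loc = (Z_v^*(½)(x_v))_v ⊔ (Z^*_{τ′_j}(½))_j` (the N4.3 bundle's `zetaStarAt` with the `L`-factors re-pointed
  to the N4 side's, `withLfac`, exactly as `TauDatum.assemble_loc_arch` reads them);
* `tauDatumV v sph : TauDatum (sideV V v) s` for ANY N4 side `s` with finitely many finite places and an
  unramified datum `sph` — `Pure = range assembleV`, `dv = 1`, the four `assemble_*` fields by `rfl`;
* GQT Theorem 11.4(ii) + (11.3) (`rallis`) holds on it whenever `v ≠ 0`: the product over the toy's finitely many
  places is finite, `Θ 1 1 = v`, `Θ φ₁ 1 = φ₁ • v`, and `⟪v, φ₁ • v⟫ = φ₁ · ⟪v, v⟫ = 2 · L(1) · ∏_w loc w` by the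
  choice of `φ₁` (`⟪v, v⟫ ≠ 0`) — an IDENTITY on the toy, as in toyTd;
* GQT §11.6's unramified identity (`unramified`) holds whenever the unramified datum has local value `1`
  (`Z_v^*(½)(sph v) = 1 = 1⁻¹`);
* on `bergmanNSide`: `sphB` = t6-p4's `(1, 1, 1)` at both finite places, `zvalue_sphB` (t6-p5's `toyZeta_apply`),
  `tdB v : TauDatum (sideV V v) bergmanNSide` with `tdB_rallis (hv : v ≠ 0)` and `tdB_unramified`; and t6-p5's
  GQT Prop. 11.6(i) instances on `toyFinitePlaces` (`prop35_split`, `prop35_nonsplit`, from `N42Toy.toyZeta_gqt`).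
Nothing here is consumed by a declared M2 object; the joint carrier's instantiation (`v := f_A`, `f_A ≠ 0` by
t6-p3's `fA_ne_zero`) is the v7 assembly file's. Neither display is closed by `trivial` / `simp` / `decide` /
`exact ⟨⟩` on a general datum (t6-p4's non-vacuity record, T6N41TauToy). §8(d): uses an L-value-free non-vanishing
device: NO.
-/

namespace Summit.Ventures.HodgeRepro2.T6
namespace PeriodInputToy2Tau

open scoped InnerProductSpace
open N3ToyV N42ToyNSide N42Toy N43Toy

/-! ## 1. The test datum on `sideV V v` over an N4 side with finitely many finite places -/

section Generic

variable (V : Type) [NormedAddCommGroup V] [InnerProductSpace ℂ V] (s : NSide) [Fintype s.d42.Place]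

/-- The archimedean local factors of the side `s`: N4.3's `Z^*_{τ′_j}(½)` on its bundle with the `L`-factors
re-pointed to the side's (`withLfac`), as the τ′ layer reads them (`TauDatum.assemble_loc_arch`). -/
noncomputable def zArch (j : Fin 3) : ℂ :=
  (s.d43.withLfac fun j => s.d41.Lv (Sum.inr j)).zetaStarAt j

/-- The assembly on the side `sideV V v`: the finite family `x` of local test data gives the quadruple
`(φ₁, 1, 1, 1)` with `φ₁ = 2 · L(1) · ∏_v Z_v^*(½)(x_v) · ∏_j Z^*_{τ′_j}(½) · ⟪v, v⟫⁻¹` and the local factors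
`Z_v^*(½)(x_v)` / `zArch`. -/
noncomputable def assembleV (v : V) (x : ∀ w, s.LocalTest w) : PureData (sideV V v) s where
  φ₁ := 2 * s.d41.L 1 * ((∏ w, s.zvalue w (x w)) * ∏ j, zArch s j) * (⟪v, v⟫_ℂ)⁻¹
  φ₂ := 1
  f₁ := 1
  f₂ := 1
  loc := Sum.elim (fun w => s.zvalue w (x w)) (zArch s)

/-- The pure-tensor test datum on `sideV V v` over `s`, for an unramified datum `sph`: `Pure` = the range of
the assembly, `d_v = 1`. -/
noncomputable def tauDatumV (v : V) (sph : ∀ w, s.LocalTest w) : TauDatum (sideV V v) s where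
  Pure := Set.range (assembleV V s v)
  sph := sph
  dv _ := 1
  dv_ne_zero _ _ := one_ne_zero
  assemble := assembleV V s v
  assemble_pure x _ := ⟨x, rfl⟩
  assemble_loc_fin _ _ := rfl
  assemble_loc_arch _ _ := rfl
  assemble_f₁_mem _ := Submodule.mem_inf.2 ⟨Submodule.mem_top, Submodule.mem_top⟩

variable {V s}

/-- GQT Theorem 11.4(ii) + (11.3) on the test datum of `sideV V v`, `v ≠ 0`: the product over the side's
finitely many places is finite, and `⟪Θ 1 1, Θ φ₁ 1⟫ = φ₁ · ⟪v, v⟫ = 2 · L(1) · ∏_w loc w` by the choice of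
`φ₁`. -/
theorem rallis {v : V} (hv : v ≠ 0) (sph : ∀ w, s.LocalTest w) :
    Hyp.GQT2014_Thm11_4_ii_Rallis (tauDatumV V s v sph) := by
  intro _ p hp
  obtain ⟨x, rfl⟩ := (show p ∈ Set.range (assembleV V s v) from hp)
  refine ⟨(hasSum_fintype _).summable, ?_⟩
  show ⟪thetaV V v (1 : ℂ) (1 : ℂ), thetaV V v (assembleV V s v x).φ₁ (1 : ℂ)⟫_ℂ =
    2 * s.d41.L 1 * ∏' w, (assembleV V s v x).loc w
  rw [thetaV_apply, thetaV_apply, tprod_fintype, Fintype.prod_sum_type]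
  simp only [assembleV, Sum.elim_inl, Sum.elim_inr, map_one, mul_one, one_smul, inner_smul_right]
  have hvv : ⟪v, v⟫_ℂ ≠ 0 := inner_self_ne_zero.mpr hv
  field_simp

/-- GQT §11.6's unramified identity on the test datum, for an unramified datum of local value `1`:
`Z_v^*(½)(sph v) = 1 = 1⁻¹`. -/
theorem unramified (v : V) (sph : ∀ w, s.LocalTest w) (hsph : ∀ w, s.zvalue w (sph w) = 1) :
    Hyp.GQT2014_Sec11_6_Unramified (tauDatumV V s v sph) := by
  intro w _
  show s.zvalue w (sph w) = (1 : ℂ)⁻¹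
  rw [hsph w, inv_one]

end Generic

/-! ## 2. On `bergmanNSide` -/

section Bergman

/-- the finite places of `bergmanNSide` are t6-p5's `Unit ⊕ Unit` (a finite type) -/
instance : Fintype bergmanNSide.d42.Place := inferInstanceAs (Fintype (Unit ⊕ Unit))

/-- The unramified datum of `bergmanNSide`: `(1, 1, 1)` at both finite places (t6-p4's `sphToy` on the same
finite-places datum). -/
def sphB : ∀ w, bergmanNSide.LocalTest w
  | Sum.inl _ => ((1 : ℂ), (1 : ℂ), (1 : ℂ))
  | Sum.inr _ => ((1 : ℂ), (1 : ℂ), (1 : ℂ))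

/-- The local value of `bergmanNSide` on the unramified datum is `1 · 1 · 1 = 1` at both finite places. -/
theorem zvalue_sphB (w : bergmanNSide.d42.Place) : bergmanNSide.zvalue w (sphB w) = 1 := by
  cases w
  · exact (toyZeta_apply toyPair (LinearEquiv.refl ℂ ℂ) (1 / 2) 1 1 (1 : ℂ)).trans
      (by rw [one_mul, one_mul]; rfl)
  · exact (toyZeta_apply (toyTower.pair 1) (LinearEquiv.refl ℂ ℂ) (1 / 2) 1 1 (1 : ℂ)).trans
      (by rw [one_mul, one_mul]; rfl)

variable (V : Type) [NormedAddCommGroup V] [InnerProductSpace ℂ V]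

/-- The test datum of the joint toy's side `sideV V v` over its N4 side `bergmanNSide`. -/
noncomputable def tdB (v : V) : TauDatum (sideV V v) bergmanNSide :=
  tauDatumV V bergmanNSide v sphB

variable {V}

/-- GQT Theorem 11.4(ii) + (11.3) on `tdB v`, `v ≠ 0`. -/
theorem tdB_rallis {v : V} (hv : v ≠ 0) : Hyp.GQT2014_Thm11_4_ii_Rallis (tdB V v) :=
  rallis hv sphB

/-- GQT §11.6's unramified identity on `tdB v`. -/
theorem tdB_unramified (v : V) : Hyp.GQT2014_Sec11_6_Unramified (tdB V v) :=
  unramified v sphB zvalue_sphB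

/-- GQT Prop. 11.6(i) at the split place of `toyFinitePlaces` (t6-p5's `toyZeta_gqt` on the toy pair). -/
theorem prop35_split (w : toyFinitePlaces.SplitPlace) :
    Hyp.GQT2014_Prop35_i (toyFinitePlaces.splitDatum w).pair (toyFinitePlaces.zetaSplit w) :=
  toyZeta_gqt toyPair (LinearEquiv.refl ℂ ℂ) toyPair_thetaNonzero

/-- GQT Prop. 11.6(i) at the non-split place of `toyFinitePlaces` (the toy tower at index `1`). -/
theorem prop35_nonsplit (w : toyFinitePlaces.NonsplitPlace) :
    Hyp.GQT2014_Prop35_i ((toyFinitePlaces.towerDatum w).pair 1) (toyFinitePlaces.zetaNonsplit w) :=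
  toyZeta_gqt (toyTower.pair 1) (LinearEquiv.refl ℂ ℂ) (toyTower_occurs 1)

end Bergman

end PeriodInputToy2Tau
end Summit.Ventures.HodgeRepro2.T6
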